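import Mathlib
import Literature.NumberTheory.Automorphic.HilbertModularFormQExpansion
import Summits.Langlands.Langlands.Theorems.CapacityClassicalityHilbertIntegralOverconvergentIsCongruenceKoecherGlue
import Summits.Langlands.Langlands.Theorems.CapacityClassicalityHilbertIntegralOverconvergentIsCongruenceStubTotallyRealEmbeddings
import Summits.Langlands.Langlands.Theorems.CapacityClassicalityHilbertIntegralOverconvergentIsCongruenceFourierKoecher
import Summits.Langlands.Langlands.Theorems.CapacityClassicalityHilbertIntegralOverconvergentIsCongruenceStubSlashMul
import Summits.Langlands.Langlands.Theorems.CapacityClassicalityHilbertIntegralOverconvergentIsCongruenceStubSlashHolomorphic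
import Summits.Langlands.Langlands.Theorems.CapacityClassicalityHilbertIntegralOverconvergentIsCongruenceStubConjPrincipalCongruence
import Summits.Langlands.Langlands.Theorems.CapacityClassicalityHilbertIntegralOverconvergentIsCongruenceStubRescale
import Summits.Langlands.Langlands.Theorems.CapacityClassicalityHilbertIntegralOverconvergentIsCongruenceStubUnitCongruenceSqFiniteIndex
import Summits.Langlands.Langlands.Theorems.CapacityClassicalityHilbertIntegralOverconvergentIsCongruenceStubFourierCoeffAtOfHasSum
import Summits.Langlands.Langlands.Theorems.CapacityClassicalityHilbertIntegralOverconvergentIsCongruenceStubQSeriesHolomorphic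

/-!
# The Koecher principle for Hilbert modular forms and `q`-series with prescribed coefficients (section M endpoints)

Endpoints of RESHAPE 9 (section M) of line Sketch-ideate-r1-k1 for the crux `HilbertIntegralOverconvergentIsCongruence`
(stmt-Langlands-8485), in the vocabulary `Literature.NumberTheory.Automorphic.HilbertModular`:

* `koecherPrinciple` — **Freitag, *Hilbert Modular Forms*, Ch. I Prop. 4.9 Cor.**: for `[F:ℚ] ≥ 2`, a holomorphic `f` on `ℍ`
  with the weight-`k` law under a congruence subgroup `Γ ⊇ Γ(𝔫)`, `𝔫 ≠ 0` (and `0` off `ℍ`) IS a Hilbert modular form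
  (`HilbertModular.IsModularForm Γ k f`): boundedness at every cusp `g ∈ SL₂(F)` is automatic.  At the cusp `g`, `h = f|_k g`
  is holomorphic (`stub_slash_holomorphic`), `g⁻¹Γ(𝔫)g` contains translations by an ideal `𝔪 ≠ 0` and `diag(ε, ε⁻¹)` for
  `ε ≡ 1 (mod 𝔪)` (`stub_conj_principal_congruence`), so by the slash action law (`stub_slash_mul`) `h` is `𝔪`-periodic and
  unit-equivariant; squares of congruence units have finite index (`stub_unitCongruence_sq_finiteIndex`); rescaling `z ↦ Nz`
  (`stub_rescale`, `N = Nm 𝔪`) and `isBoundedAtInfty_of_unit_equivariant` (Götzky–Koecher, section L) finish.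
* `qSeriesPackage` — `∑_{ν ∈ 𝔡⁻¹} a_ν e^{2πi S(νz)}` with `∑|a_ν|e^{-2π⟨ν,y⟩} < ∞` at all heights is holomorphic, `𝓞 F`-periodic
  and has `fourierCoeffAt = a` (`stub_qSeries_holomorphic`, `stub_fourierCoeffAt_of_hasSum`).
-/

set_option linter.dupNamespace false

noncomputable section

namespace Summit.Langlands.Langlands.Theorems.HilbertIntegralOverconvergentIsCongruence

open MeasureTheory Complex NumberField
open Literature.NumberTheory.Automorphic Literature.NumberTheory.Automorphic.HilbertModular
open scoped MatrixGroups


variable {F : Type} [Field F] [NumberField F]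

omit [NumberField F] in
/-- Entries of a special linear matrix from an equality of its underlying matrix with an explicit one. -/
theorem kp_entries_of_coe_eq {t : SL(2, F)} {a b c d : F} (ht : (t : Matrix (Fin 2) (Fin 2) F) = !![a, b; c, d]) :
    t 0 0 = a ∧ t 0 1 = b ∧ t 1 0 = c ∧ t 1 1 = d := by
  have h : ∀ i j, t i j = !![a, b; c, d] i j := fun i j ↦ by rw [← ht]
  exact ⟨by simpa using h 0 0, by simpa using h 0 1, by simpa using h 1 0, by simpa using h 1 1⟩

/-- The translation `z ↦ z + a` as a Möbius map: action and automorphy factor. -/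
theorem kp_moeb_transl {t : SL(2, F)} {a : F} (ht : (t : Matrix (Fin 2) (Fin 2) F) = !![1, a; 0, 1])
    (k : (F →+* ℝ) → ℤ) (z : Point F) :
    moeb t z = (fun σ ↦ z σ + ((σ a : ℝ) : ℂ)) ∧ autFactor k t z = 1 := by
  obtain ⟨h00, h01, h10, h11⟩ := kp_entries_of_coe_eq ht
  refine ⟨funext fun σ ↦ ?_, ?_⟩
  · simp [moeb, denom, h00, h01, h10, h11]
  · simp [autFactor, denom, h10, h11]

/-- The diagonal unit matrix `diag(ε, ε⁻¹)` as a Möbius map: `z ↦ ε² z`, automorphy factor `∏_σ σ(ε⁻¹)^{k_σ}`. -/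
theorem kp_moeb_diag {t : SL(2, F)} {ε : (𝓞 F)ˣ}
    (ht : (t : Matrix (Fin 2) (Fin 2) F) = !![((ε : 𝓞 F) : F), 0; 0, (((ε⁻¹ : (𝓞 F)ˣ) : 𝓞 F) : F)])
    (k : (F →+* ℝ) → ℤ) (z : Point F) :
    moeb t z = (fun σ ↦ ((σ ((ε : 𝓞 F) : F) : ℝ) : ℂ) ^ 2 * z σ) ∧
      autFactor k t z = ∏ σ : F →+* ℝ, ((σ (((ε⁻¹ : (𝓞 F)ˣ) : 𝓞 F) : F) : ℝ) : ℂ) ^ k σ := by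
  obtain ⟨h00, h01, h10, h11⟩ := kp_entries_of_coe_eq ht
  have hinv : (((ε⁻¹ : (𝓞 F)ˣ) : 𝓞 F) : F) * ((ε : 𝓞 F) : F) = 1 := by
    rw [← map_mul, Units.inv_mul, map_one]
  have hσinv : ∀ σ : F →+* ℝ, (σ (((ε⁻¹ : (𝓞 F)ˣ) : 𝓞 F) : F) : ℂ) * (σ ((ε : 𝓞 F) : F) : ℂ) = 1 := by
    intro σ
    have h := congrArg (fun x : F ↦ ((σ x : ℝ) : ℂ)) hinv
    simp only [map_mul, map_one, Complex.ofReal_mul, Complex.ofReal_one] at h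
    exact h
  refine ⟨funext fun σ ↦ ?_, ?_⟩
  · have hinvσ : ((σ (((ε⁻¹ : (𝓞 F)ˣ) : 𝓞 F) : F) : ℝ) : ℂ) = (((σ ((ε : 𝓞 F) : F) : ℝ) : ℂ))⁻¹ :=
      eq_inv_of_mul_eq_one_left (hσinv σ)
    simp only [moeb, denom, h00, h01, h10, h11, map_zero, Complex.ofReal_zero, zero_mul, add_zero, zero_add,
      hinvσ, div_inv_eq_mul]
    ring
  · simp [autFactor, denom, h10, h11]


/-- The size of a `q`-monomial term: `|a e^{2πi S(νz)}| = |a| e^{-2π ∑_σ σ(ν) Im z_σ}`. -/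
theorem kp_norm_qTerm (a : ℂ) (ν : F) (z : Point F) :
    ‖a * cexp (2 * Real.pi * I * pairing ν z)‖ =
      ‖a‖ * Real.exp (-(2 * Real.pi * ∑ σ : F →+* ℝ, σ ν * (z σ).im)) := by
  have him : (pairing ν z).im = ∑ σ : F →+* ℝ, σ ν * (z σ).im := by
    rw [pairing, Complex.im_sum]
    exact Finset.sum_congr rfl fun σ _ ↦ Complex.im_ofReal_mul _ _
  have hre : (2 * Real.pi * I * pairing ν z).re = -(2 * Real.pi * ∑ σ : F →+* ℝ, σ ν * (z σ).im) := by
    rw [← him]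
    simp [Complex.mul_re]
  rw [norm_mul, Complex.norm_exp, hre]

omit [NumberField F] in
/-- Scaling a point of `ℍ` by a positive natural number stays in `ℍ`. -/
theorem kp_natMul_mem_halfSpace {N : ℕ} (hN : 0 < N) {z : Point F} (hz : z ∈ halfSpace F) :
    (fun σ ↦ (N : ℂ) * z σ) ∈ halfSpace F := fun σ ↦ by
  simp only [Complex.mul_im, Complex.natCast_re, Complex.natCast_im, zero_mul, add_zero]
  exact mul_pos (Nat.cast_pos.2 hN) (hz σ)

/-- **The Koecher principle for Hilbert modular forms** (Freitag I.4.9 Cor.): over a totally real field of degree `≥ 2`, a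
holomorphic function on `ℍ` with the weight-`k` transformation law under a congruence subgroup `Γ ⊇ Γ(𝔫)`, `𝔫 ≠ 0`, of
`SL₂(𝓞 F)` and normalised to `0` off `ℍ` is a Hilbert modular form — the cusp condition `bounded_at_cusps` at every cusp is
automatic (M-A1, M-A6, M-A3, M-A4, M-A5 and `isBoundedAtInfty_of_unit_equivariant`). [cite: Freitag1990, Ch. I Prop. 4.9] -/
theorem koecherPrinciple (F : Type) [Field F] [NumberField F] [NumberField.IsTotallyReal F]
    (hd : 1 < Module.finrank ℚ F) (𝔫 : Ideal (𝓞 F)) (h𝔫 : 𝔫 ≠ ⊥) (Γ : Subgroup SL(2, 𝓞 F))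
    (hΓ : Bianchi.Gamma 𝔫 ≤ Γ) (k : (F →+* ℝ) → ℤ) (f : Point F → ℂ) (hf : IsHolomorphicOn F f)
    (htrans : ∀ γ ∈ Γ, ∀ z ∈ halfSpace F, f (moeb (toSL2F γ) z) = autFactor k (toSL2F γ) z * f z)
    (hzero : ∀ z ∉ halfSpace F, f z = 0) : IsModularForm Γ k f := by
  classical
  refine ⟨hf, htrans, fun g ↦ ?_, hzero⟩
  set h : Point F → ℂ := slash k g f with hhdef
  have hh : IsHolomorphicOn F h := stub_slash_holomorphic F k g f hf
  obtain ⟨𝔪, h𝔪, htr, hdiag⟩ := stub_conj_principal_congruence F 𝔫 h𝔫 g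
  -- transport of the transformation law along `γ g = g t`, `γ ∈ Γ(𝔫) ≤ Γ`
  have transport : ∀ t : SL(2, F), (∃ γ ∈ Bianchi.Gamma 𝔫, toSL2F γ * g = g * t) →
      ∀ z ∈ halfSpace F, h (moeb t z) = autFactor k t z * h z := by
    rintro t ⟨γ, hγ, hconj⟩ z hz
    have hγΓ : γ ∈ Γ := hΓ hγ
    have hfix : ∀ w ∈ halfSpace F, slash k (toSL2F γ) f w = f w := by
      intro w hw
      simp only [slash]
      rw [htrans γ hγΓ w hw, ← mul_assoc, inv_mul_cancel₀ (autFactor_ne_zero k _ hw), one_mul]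
    obtain ⟨hgz, -, -, hsl1⟩ := stub_slash_mul F k (toSL2F γ) g f z hz
    have e1 : slash k (toSL2F γ * g) f z = h z := by
      rw [hsl1]
      show (autFactor k g z)⁻¹ * slash k (toSL2F γ) f (moeb g z) = slash k g f z
      rw [hfix _ hgz]
      rfl
    obtain ⟨-, -, -, hsl2⟩ := stub_slash_mul F k g t f z hz
    have e2 : slash k (g * t) f z = (autFactor k t z)⁻¹ * h (moeb t z) := by
      rw [hsl2, hhdef]
      rfl
    rw [← hconj, e1] at e2
    rw [e2, ← mul_assoc, mul_inv_cancel₀ (autFactor_ne_zero k t hz), one_mul]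
  -- translations by `𝔪`
  have hper𝔪 : ∀ a : 𝓞 F, a ∈ 𝔪 → ∀ z ∈ halfSpace F, h (fun σ ↦ z σ + ((σ (a : F) : ℝ) : ℂ)) = h z := by
    intro a ha z hz
    obtain ⟨t, ht, hγ⟩ := htr a ha
    obtain ⟨hmoeb, haut⟩ := kp_moeb_transl ht k z
    have key := transport t hγ z hz
    rwa [hmoeb, haut, one_mul] at key
  -- the multipliers of the diagonal units
  set d : (𝓞 F)ˣ → ℂ := fun ε ↦ ∏ σ : F →+* ℝ, ((σ (((ε⁻¹ : (𝓞 F)ˣ) : 𝓞 F) : F) : ℝ) : ℂ) ^ k σ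
    with hddef
  have hd_ne : ∀ ε, d ε ≠ 0 := by
    intro ε
    refine Finset.prod_ne_zero_iff.2 fun σ _ ↦ zpow_ne_zero _ ?_
    have hε : (((ε⁻¹ : (𝓞 F)ˣ) : 𝓞 F) : F) ≠ 0 :=
      mt RingOfIntegers.coe_eq_zero_iff.mp (Units.ne_zero _)
    exact_mod_cast (map_ne_zero σ).2 hε
  have hunit : ∀ ε : (𝓞 F)ˣ, (ε : 𝓞 F) - 1 ∈ 𝔪 → ∀ z ∈ halfSpace F,
      h (fun σ ↦ ((σ ((ε : 𝓞 F) : F) : ℝ) : ℂ) ^ 2 * z σ) = d ε * h z := by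
    intro ε hε z hz
    obtain ⟨t, ht, hγ⟩ := hdiag ε hε
    obtain ⟨hmoeb, haut⟩ := kp_moeb_diag ht k z
    have key := transport t hγ z hz
    rwa [hmoeb, haut] at key
  -- a finite-index group of totally positive multipliers
  obtain ⟨U, hU, hUsq⟩ := stub_unitCongruence_sq_finiteIndex F 𝔪 h𝔪
  set c : (𝓞 F)ˣ → ℂ := fun η ↦
    if hη : ∃ ε : (𝓞 F)ˣ, (ε : 𝓞 F) - 1 ∈ 𝔪 ∧ η = ε ^ 2 then d hη.choose else 1 with hcdef
  have hc : ∀ η ∈ U, c η ≠ 0 := by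
    intro η _
    simp only [hcdef]
    split_ifs with hη
    · exact hd_ne _
    · exact one_ne_zero
  -- rescaling by `N = Nm(𝔪) ∈ 𝔪`
  set N : ℕ := Ideal.absNorm 𝔪 with hNdef
  have hN : 0 < N := Nat.pos_of_ne_zero fun h0 ↦ h𝔪 (Ideal.absNorm_eq_zero_iff.1 h0)
  have hNmem : ((N : ℕ) : 𝓞 F) ∈ 𝔪 := Ideal.absNorm_mem 𝔪
  set hN_fun : Point F → ℂ := fun z ↦ h (fun σ ↦ (N : ℂ) * z σ) with hN_fun_def
  have hhol_N : IsHolomorphicOn F hN_fun := (stub_rescale F h N hN).1 hh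
  have hper_N : ∀ (b : 𝓞 F) (z : Point F), z ∈ halfSpace F →
      hN_fun (fun σ ↦ z σ + ((σ (b : F) : ℝ) : ℂ)) = hN_fun z := by
    intro b z hz
    have hmem : ((N : ℕ) : 𝓞 F) * b ∈ 𝔪 := 𝔪.mul_mem_right b hNmem
    have key := hper𝔪 (((N : ℕ) : 𝓞 F) * b) hmem (fun σ ↦ (N : ℂ) * z σ) (kp_natMul_mem_halfSpace hN hz)
    simp only [hN_fun_def]
    convert key using 2
    funext σ
    push_cast [map_mul, map_natCast]
    ring
  have hmod_N : ∀ η ∈ U, (∀ σ : F →+* ℝ, 0 < σ ((η : 𝓞 F) : F)) → ∀ z ∈ halfSpace F,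
      hN_fun (fun σ ↦ ((σ ((η : 𝓞 F) : F) : ℝ) : ℂ) * z σ) = c η * hN_fun z := by
    intro η hη _ z hz
    have hex : ∃ ε : (𝓞 F)ˣ, (ε : 𝓞 F) - 1 ∈ 𝔪 ∧ η = ε ^ 2 := hUsq η hη
    have hcη : c η = d hex.choose := by simp only [hcdef, dif_pos hex]
    obtain ⟨hε1, hηε⟩ := hex.choose_spec
    have key := hunit hex.choose hε1 (fun σ ↦ (N : ℂ) * z σ) (kp_natMul_mem_halfSpace hN hz)
    simp only [hN_fun_def]
    rw [hcη]
    have hval : ((η : 𝓞 F) : F) = ((hex.choose : 𝓞 F) : F) ^ 2 := by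
      have hc2 := congrArg (fun u : (𝓞 F)ˣ ↦ ((u : 𝓞 F) : F)) hηε
      simpa [Units.val_pow_eq_pow_val] using hc2
    convert key using 2
    funext σ
    rw [hval, map_pow]
    push_cast
    ring
  have hbN : IsBoundedAtInfty F hN_fun := isBoundedAtInfty_of_unit_equivariant F hd hN_fun hhol_N hper_N U hU c hc hmod_N
  exact (stub_rescale F h N hN).2 hbN

/-- **`q`-series with prescribed coefficients** (Freitag I.4.1/4.3): for `∑_{ν ∈ 𝔡⁻¹} |a_ν| e^{-2π⟨ν,y⟩} < ∞` at every height,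
`q(z) = ∑_{ν ∈ 𝔡⁻¹} a_ν e^{2πi S(νz)}` is holomorphic on `ℍ`, `𝓞 F`-periodic on `ℍ`, and `fourierCoeffAt q ν y = a_ν`
(M-B3, M-B2, K-D). [cite: Freitag1990, Ch. I Lemma 4.1] -/
theorem qSeriesPackage (F : Type) [Field F] [NumberField F] [NumberField.IsTotallyReal F] (a : F → ℂ)
    (habs : ∀ y : (F →+* ℝ) → ℝ, (∀ σ, 0 < y σ) →
      Summable (fun ν : {ν : F | ∀ b : 𝓞 F, ∃ n : ℤ, Algebra.trace ℚ F (ν * b) = n} ↦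
        ‖a ν‖ * Real.exp (-(2 * Real.pi * ∑ σ : F →+* ℝ, σ (ν : F) * y σ)))) :
    IsHolomorphicOn F (fun z ↦ ∑' ν : {ν : F | ∀ b : 𝓞 F, ∃ n : ℤ, Algebra.trace ℚ F (ν * b) = n},
        a ν * cexp (2 * Real.pi * I * pairing (ν : F) z)) ∧
    (∀ (b : 𝓞 F) (z : Point F), z ∈ halfSpace F →
      (∑' ν : {ν : F | ∀ b : 𝓞 F, ∃ n : ℤ, Algebra.trace ℚ F (ν * b) = n},
          a ν * cexp (2 * Real.pi * I * pairing (ν : F) (fun σ ↦ z σ + ((σ (b : F) : ℝ) : ℂ)))) =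
        ∑' ν : {ν : F | ∀ b : 𝓞 F, ∃ n : ℤ, Algebra.trace ℚ F (ν * b) = n},
          a ν * cexp (2 * Real.pi * I * pairing (ν : F) z)) ∧
    ∀ (ν : F), (∀ b : 𝓞 F, ∃ n : ℤ, Algebra.trace ℚ F (ν * b) = n) →
      ∀ y : (F →+* ℝ) → ℝ, (∀ σ, 0 < y σ) →
        fourierCoeffAt (fun z ↦ ∑' μ : {ν : F | ∀ b : 𝓞 F, ∃ n : ℤ, Algebra.trace ℚ F (ν * b) = n},
          a μ * cexp (2 * Real.pi * I * pairing (μ : F) z)) ν y = a ν := by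
  obtain ⟨htr, -⟩ :=
    stub_totallyReal_embeddings F
  refine ⟨stub_qSeries_holomorphic F _ a habs, ?_, ?_⟩
  · intro b z _
    refine tsum_congr fun ν ↦ ?_
    obtain ⟨n, hn⟩ :=
      koe_sum_mul_embedding_int
        htr ν.2 b
    have hphase : pairing (ν : F) (fun σ ↦ z σ + ((σ (b : F) : ℝ) : ℂ)) = pairing (ν : F) z + n := by
      simp only [pairing, mul_add, Finset.sum_add_distrib]
      congr 1
      exact_mod_cast hn
    rw [hphase, mul_add, Complex.exp_add]
    have h1 : cexp (2 * Real.pi * I * (n : ℂ)) = 1 := by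
      rw [show 2 * Real.pi * I * (n : ℂ) = n * (2 * Real.pi * I) by ring]
      exact Complex.exp_int_mul_two_pi_mul_I n
    rw [h1, mul_one]
  · intro ν hν y hy
    refine stub_fourierCoeffAt_of_hasSum F _ a y (fun x ↦ ?_) (habs y hy) ν hν
    have hs : Summable (fun μ : {ν : F | ∀ b : 𝓞 F, ∃ n : ℤ, Algebra.trace ℚ F (ν * b) = n} ↦
        a μ * cexp (2 * Real.pi * I * pairing (μ : F) (cubePoint x y))) := by
      refine Summable.of_norm ((habs y hy).congr fun μ ↦ ?_)
      rw [kp_norm_qTerm]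
      simp [koe_cubePoint_im]
    exact hs.hasSum

end Summit.Langlands.Langlands.Theorems.HilbertIntegralOverconvergentIsCongruence
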